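import Literature.Computability.MetaComplexity.TseitinDepthFregeTransfer
import Literature.Computability.MetaComplexity.Resolution
import Summits.PneNP.PneNP.Theorems.ExpanderLinearGeneratorsDepthSevenNodes

/-!
# PneNP / ExpanderLinearGenerators — bounded-depth `textbookFrege` p-simulates resolution

Route `PneNP/ExpanderLinearGenerators`, support for crux stmt-PneNP-11443
(`LinearGeneratorDepthFregeHard`): the infrastructure that turns the bounded-depth Frege lower
bounds of the route (`ColumnTwo.linearGeneratorDepthFregeHard_of_colWeight_le_two`,
`LinGen.linearGeneratorDepthFregeHard_of_light_expansion`) into resolution lower bounds at every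
expansion scale (companion file `…ResolutionRung`). A resolution refutation `ρ` of a CNF `T`
(the tree's dag-like calculus with weakening, `IsResRefutation`, clauses as finite sets of
literals) all of whose clauses have at most `W` literals is turned into a depth-`13`
`textbookFrege` proof of `¬ ofCNF T` of size polynomial in `|ρ|`, `W` and `|ofCNF T|`:
the clause `C` of a line becomes the formula `¬Φ ∨ ⋁C` (`Φ = ofCNF T`); an initial clause is a
conjunct extraction, a resolution step `C ∨ x, D ∨ ¬x ⊢ E` is the tautology
`¬(¬Φ ∨ ⋁C) ∨ (¬(¬Φ ∨ ⋁D) ∨ (¬Φ ∨ ⋁E))` — an axiom of Shoenfield's calculus followed by the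
structural rule and one cut, derived ONCE, stand-alone — and two modus ponens steps inside the
running proof, so that the dag structure is respected (every earlier line is reused, never
re-derived).

* `mp_in` — modus ponens inside a running derivation (5 lines);
* `initialTaut`, `resolveTaut`, `weakenTaut`, `finalTaut` — the stand-alone pieces;
* (the simulation itself is `ResSim.exists_proof_of_isResRefutation` in the companion file
  `…ExpanderLinearGeneratorsResSim`).

References: J. Krajíček, *Proof complexity* (CUP 2019), §5.1 (R); the
p-simulation of resolution by Frege systems is folklore (Cook–Reckhow 1979, §2); J. Shoenfield,
*Mathematical Logic* (1967), §2.6, §3.1 (the calculus and its structural rules).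
-/

namespace Summit.PneNP.PneNP.Theorems.ResSim

open Literature.Computability.MetaComplexity Literature.Computability.MetaComplexity.TextbookFrege
open Literature.Computability.Complexity (PropForm Clause CNF Literal)
open Literature.Computability.Complexity.PropForm
open Literature.Computability.MetaComplexity.KrajicekRamsey (litOf clauseOf dd_clauseOf_le dd_litOf_le)

variable {D B : ℕ}

/-! ### Running derivations containing given formulas -/

/-- The empty running derivation. [folklore] -/
theorem cont_nil : ∃ Pd : List (PropForm ℕ), textbookFrege.IsDerivation ∅ Pd ∧
    (∀ φ ∈ ([] : List (PropForm ℕ)), φ ∈ Pd) ∧ Pd.length ≤ 0 ∧ ∀ ψ ∈ Pd, LineOK D B ψ :=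
  ⟨[], FregeSystem.isDerivation_nil _ _, by simp, by simp, by simp⟩

/-- Appending a stand-alone bounded derivation to a running derivation. [folklore] -/
theorem cont_absorb {ℓ ℓ' : ℕ} {S : List (PropForm ℕ)} {φ : PropForm ℕ}
    (h : ∃ Pd : List (PropForm ℕ), textbookFrege.IsDerivation ∅ Pd ∧
      (∀ ψ ∈ S, ψ ∈ Pd) ∧ Pd.length ≤ ℓ ∧ ∀ ψ ∈ Pd, LineOK D B ψ)
    (hφ : BD D B ℓ' φ) :
    ∃ Pd : List (PropForm ℕ), textbookFrege.IsDerivation ∅ Pd ∧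
      (∀ ψ ∈ φ :: S, ψ ∈ Pd) ∧ Pd.length ≤ ℓ + ℓ' ∧ ∀ ψ ∈ Pd, LineOK D B ψ := by
  obtain ⟨Pd, hPd, hS, hlen, hok⟩ := h
  obtain ⟨π, hπ, hlast, hlen', hok'⟩ := hφ
  refine ⟨Pd ++ π, hPd.append hπ, ?_, by rw [List.length_append]; omega, ?_⟩
  · intro ψ hψ
    rcases List.mem_cons.1 hψ with rfl | hψ
    · exact List.mem_append_right _ (List.mem_of_getLast? hlast)
    · exact List.mem_append_left _ (hS ψ hψ)
  · intro ψ hψ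
    rcases List.mem_append.1 hψ with hψ | hψ
    · exact hok ψ hψ
    · exact hok' ψ hψ

/-- Appending one inferred line to a running derivation. [folklore] -/
theorem cont_infer {ℓ : ℕ} {S : List (PropForm ℕ)} {θ : PropForm ℕ}
    (h : ∃ Pd : List (PropForm ℕ), textbookFrege.IsDerivation ∅ Pd ∧
      (∀ ψ ∈ S, ψ ∈ Pd) ∧ Pd.length ≤ ℓ ∧ ∀ ψ ∈ Pd, LineOK D B ψ)
    (hinf : ∀ Pd : List (PropForm ℕ), (∀ ψ ∈ S, ψ ∈ Pd) → textbookFrege.IsInferred Pd θ)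
    (hl : LineOK D B θ) :
    ∃ Pd : List (PropForm ℕ), textbookFrege.IsDerivation ∅ Pd ∧
      (∀ ψ ∈ θ :: S, ψ ∈ Pd) ∧ Pd.length ≤ ℓ + 1 ∧ (∀ ψ ∈ Pd, LineOK D B ψ) ∧
      Pd.getLast? = some θ := by
  obtain ⟨Pd, hPd, hS, hlen, hok⟩ := h
  refine ⟨Pd ++ [θ], isDerivation_append_of_isInferred hPd (hinf Pd hS), ?_,
    by rw [List.length_append, List.length_singleton]; omega, ?_, by simp⟩
  · intro ψ hψ
    rcases List.mem_cons.1 hψ with rfl | hψ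
    · exact List.mem_append_right _ (List.mem_singleton.2 rfl)
    · exact List.mem_append_left _ (hS ψ hψ)
  · intro ψ hψ
    rcases List.mem_append.1 hψ with hψ | hψ
    · exact hok ψ hψ
    · rw [List.mem_singleton] at hψ
      exact hψ ▸ hl

/-- **Modus ponens inside a running derivation.** If `A` and `¬A ∨ F` occur in the running
derivation then `F` is reached in five more lines (expansion `F ∨ A`, axiom `¬F ∨ F`, cut to
`A ∨ F`, cut to `F ∨ F`, contraction), the last line being `F`. [Shoenfield 1967, §2.6]
[folklore] -/
theorem mp_in {ℓ : ℕ} {S : List (PropForm ℕ)} {A F : PropForm ℕ} (hA : A ∈ S)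
    (hAF : disj (neg A) F ∈ S)
    (h : ∃ Pd : List (PropForm ℕ), textbookFrege.IsDerivation ∅ Pd ∧
      (∀ ψ ∈ S, ψ ∈ Pd) ∧ Pd.length ≤ ℓ ∧ ∀ ψ ∈ Pd, LineOK D B ψ)
    (hdA : A.dd ≤ D) (hdF : F.dd ≤ D) (hdnF : (neg F).dd ≤ D)
    (hs : 2 * (A.size + F.size) + 2 ≤ B) :
    ∃ Pd : List (PropForm ℕ), textbookFrege.IsDerivation ∅ Pd ∧
      (∀ ψ ∈ F :: S, ψ ∈ Pd) ∧ Pd.length ≤ ℓ + 5 ∧ (∀ ψ ∈ Pd, LineOK D B ψ) ∧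
      Pd.getLast? = some F := by
  -- 1. expansion `F ∨ A`
  have h1 := cont_infer (θ := disj F A) h (fun Pd hPd =>
      ⟨⟨[var 0], disj (var 1) (var 0)⟩, by simp [textbookFrege], sub3 A F F, rfl, fun p hp => by
        simp only [List.mem_singleton] at hp; subst hp
        exact hPd _ (by simp [PropForm.subst, sub3, hA])⟩)
    ⟨by simp only [dd_disj]; omega, by simp only [size]; omega⟩
  -- 2. axiom `¬F ∨ F`
  have h2 := cont_infer (θ := disj (neg F) F) ⟨_, h1.choose_spec.1, h1.choose_spec.2.1,
      h1.choose_spec.2.2.1, h1.choose_spec.2.2.2.1⟩ (fun Pd _ =>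
      ⟨⟨[], disj (neg (var 0)) (var 0)⟩, by simp [textbookFrege], sub3 F F F, rfl, fun p hp => by
        simp at hp⟩)
    ⟨by simp only [dd_disj]; omega, by simp only [size]; omega⟩
  -- 3. cut `A ∨ F` from `F ∨ A` and `¬F ∨ F`
  have h3 := cont_infer (θ := disj A F) ⟨_, h2.choose_spec.1, h2.choose_spec.2.1,
      h2.choose_spec.2.2.1, h2.choose_spec.2.2.2.1⟩ (fun Pd hPd =>
      ⟨⟨[disj (var 0) (var 1), disj (neg (var 0)) (var 2)], disj (var 1) (var 2)⟩,
        by simp [textbookFrege], sub3 F A F, rfl, fun p hp => by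
        simp only [List.mem_cons, List.not_mem_nil, or_false] at hp
        rcases hp with rfl | rfl <;> exact hPd _ (by simp [PropForm.subst, sub3])⟩)
    ⟨by simp only [dd_disj]; omega, by simp only [size]; omega⟩
  -- 4. cut `F ∨ F` from `A ∨ F` and `¬A ∨ F`
  have h4 := cont_infer (θ := disj F F) ⟨_, h3.choose_spec.1, h3.choose_spec.2.1,
      h3.choose_spec.2.2.1, h3.choose_spec.2.2.2.1⟩ (fun Pd hPd =>
      ⟨⟨[disj (var 0) (var 1), disj (neg (var 0)) (var 2)], disj (var 1) (var 2)⟩,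
        by simp [textbookFrege], sub3 A F F, rfl, fun p hp => by
        simp only [List.mem_cons, List.not_mem_nil, or_false] at hp
        rcases hp with rfl | rfl <;> exact hPd _ (by simp [PropForm.subst, sub3, hAF])⟩)
    ⟨by simp only [dd_disj]; omega, by simp only [size]; omega⟩
  -- 5. contraction `F`
  have h5 := cont_infer (θ := F) ⟨_, h4.choose_spec.1, h4.choose_spec.2.1,
      h4.choose_spec.2.2.1, h4.choose_spec.2.2.2.1⟩ (fun Pd hPd =>
      ⟨⟨[disj (var 0) (var 0)], var 0⟩, by simp [textbookFrege], sub3 F F F, rfl, fun p hp => by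
        simp only [List.mem_singleton] at hp; subst hp
        exact hPd _ (by simp [PropForm.subst, sub3])⟩)
    ⟨hdF, by omega⟩
  obtain ⟨Pd, hPd, hS, hlen, hok, hlast⟩ := h5
  refine ⟨Pd, hPd, fun ψ hψ => ?_, by omega, hok, hlast⟩
  rcases List.mem_cons.1 hψ with rfl | hψ
  · exact hS _ List.mem_cons_self
  · exact hS _ (by simp [hψ])

/-! ### Depth bookkeeping -/

/-- A sequent whose members have disjunct depth `≤ p` has disjunct depth `≤ p`, its negation
`≤ p + 2`. [folklore] -/
theorem dd_cons_le {X : PropForm ℕ} {L : List (PropForm ℕ)} {p : ℕ} (hX : X.dd ≤ p)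
    (hL : ∀ A ∈ L, A.dd ≤ p) : (disjList (X :: L)).dd ≤ p :=
  dd_disjList_le fun A hA => by
    rcases List.mem_cons.1 hA with rfl | hA
    · exact hX
    · exact hL A hA

/-! ### The stand-alone pieces -/

/-- **The resolution tautology.** For sequents `Fᵢ = ⋁(Φₙ :: Lᵢ)`, `Fⱼ = ⋁(Φₙ :: Lⱼ)` and a
target `⋁(Φₙ :: L_E)` such that every member of `Lᵢ` is the pivot `x` or occurs in `L_E` and every
member of `Lⱼ` is `¬x` or occurs in `L_E`, the formula `¬Fᵢ ∨ (¬Fⱼ ∨ ⋁(Φₙ :: L_E))` has a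
bounded stand-alone derivation: the axioms `¬Fᵢ ∨ Fᵢ`, `¬Fⱼ ∨ Fⱼ`, the structural rule towards
`x, ¬Fᵢ, ¬Fⱼ, Φₙ, L_E` resp. `¬x, ¬Fᵢ, ¬Fⱼ, Φₙ, L_E`, and a cut on `x`.
[Shoenfield 1967, §2.6, §3.1] [folklore] -/
theorem resolveTaut {Li Lj LE : List (PropForm ℕ)} {Φn x : PropForm ℕ} {LF : ℕ} (hD : 10 ≤ D)
    (hΦ : Φn.dd ≤ 4) (hLi : ∀ A ∈ Li, A.dd ≤ 1) (hLj : ∀ A ∈ Lj, A.dd ≤ 1)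
    (hLE : ∀ A ∈ LE, A.dd ≤ 1) (hx : x.dd ≤ 1) (hnx : (neg x).dd ≤ 1) (hxs : x.size ≤ 1)
    (hi : ∀ A ∈ Li, A = x ∨ A ∈ LE) (hj : ∀ A ∈ Lj, A = neg x ∨ A ∈ LE)
    (hszi : (disjList (Φn :: Li)).size ≤ LF) (hszj : (disjList (Φn :: Lj)).size ≤ LF)
    (hszE : (disjList (Φn :: LE)).size ≤ LF) (hB : 16 * LF + 60 ≤ B) :
    BD D B (30 + 2 * (Li.length + Lj.length + 2) * (35 + 6 * (LE.length + 4)))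
      (disjList (neg (disjList (Φn :: Li)) :: neg (disjList (Φn :: Lj)) :: Φn :: LE)) := by
  set Fi := disjList (Φn :: Li) with hFi
  set Fj := disjList (Φn :: Lj) with hFj
  have hdFi : Fi.dd ≤ 4 := dd_cons_le hΦ fun A hA => (hLi A hA).trans (by omega)
  have hdFj : Fj.dd ≤ 4 := dd_cons_le hΦ fun A hA => (hLj A hA).trans (by omega)
  have hdnFi : (neg Fi).dd ≤ 6 := (dd_neg_le_dd_add_two Fi).trans (by omega)
  have hdnFj : (neg Fj).dd ≤ 6 := (dd_neg_le_dd_add_two Fj).trans (by omega)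
  -- members of the target lists have depth `≤ 6`
  have hp : ∀ y, y.dd ≤ 1 → ∀ X ∈ (y :: neg Fi :: neg Fj :: Φn :: LE), X.dd ≤ 6 := by
    intro y hy X hX
    simp only [List.mem_cons] at hX
    rcases hX with rfl | rfl | rfl | rfl | hX
    · omega
    · exact hdnFi
    · exact hdnFj
    · omega
    · exact (hLE X hX).trans (by omega)
  -- sizes of the target lists
  have hszT : ∀ y, y.size ≤ 2 →
      (disjList (y :: neg Fi :: neg Fj :: Φn :: LE)).size ≤ 3 * LF + 8 := by
    intro y hy
    simp only [size_disjList_cons, size] at hszE ⊢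
    omega
  -- the two axioms
  have a1 : BD D B 1 (disjList (neg Fi :: Φn :: Li)) := by
    rw [disjList_cons]
    exact axB Fi ⟨by rw [dd_disj]; omega, by simp only [size]; omega⟩
  have b1 : BD D B 1 (disjList (neg Fj :: Φn :: Lj)) := by
    rw [disjList_cons]
    exact axB Fj ⟨by rw [dd_disj]; omega, by simp only [size]; omega⟩
  -- the structural rule
  have hsz1 : (disjList (neg Fi :: Φn :: Li)).size ≤ 2 * LF + 2 := by
    rw [size_disjList_cons, size, ← hFi]; omega
  have hsz2 : (disjList (neg Fj :: Φn :: Lj)).size ≤ 2 * LF + 2 := by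
    rw [size_disjList_cons, size, ← hFj]; omega
  have a2 := subsetB (L' := x :: neg Fi :: neg Fj :: Φn :: LE) a1 (fun A hA => by
      simp only [List.mem_cons] at hA ⊢
      rcases hA with rfl | rfl | hA
      · exact Or.inr (Or.inl rfl)
      · exact Or.inr (Or.inr (Or.inr (Or.inl rfl)))
      · rcases hi A hA with rfl | hA
        · exact Or.inl rfl
        · exact Or.inr (Or.inr (Or.inr (Or.inr hA)))) (hp x hx) (by omega)
      (by have := hszT x (by omega); omega)
  have b2 := subsetB (L' := neg x :: neg Fi :: neg Fj :: Φn :: LE) b1 (fun A hA => by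
      simp only [List.mem_cons] at hA ⊢
      rcases hA with rfl | rfl | hA
      · exact Or.inr (Or.inr (Or.inl rfl))
      · exact Or.inr (Or.inr (Or.inr (Or.inl rfl)))
      · rcases hj A hA with rfl | hA
        · exact Or.inl rfl
        · exact Or.inr (Or.inr (Or.inr (Or.inr hA)))) (hp (neg x) hnx) (by omega)
      (by have := hszT (neg x) (by simp only [size]; omega); omega)
  -- the cut
  have c := cutS a2 b2 (by
      have := hszT x (by omega)
      simp only [size_disjList_cons] at this ⊢; omega)
  refine c.mono ?_
  simp only [List.length_cons]
  nlinarith [Li.length.zero_le, Lj.length.zero_le, LE.length.zero_le]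

/-- **The weakening tautology** `¬⋁(Φₙ :: Lᵢ) ∨ ⋁(Φₙ :: L_E)` when every member of `Lᵢ` occurs
in `L_E`: an axiom and the structural rule. [Shoenfield 1967, §3.1] [folklore] -/
theorem weakenTaut {Li LE : List (PropForm ℕ)} {Φn : PropForm ℕ} {LF : ℕ} (hD : 10 ≤ D)
    (hΦ : Φn.dd ≤ 4) (hLi : ∀ A ∈ Li, A.dd ≤ 1) (hLE : ∀ A ∈ LE, A.dd ≤ 1)
    (hi : ∀ A ∈ Li, A ∈ LE)
    (hszi : (disjList (Φn :: Li)).size ≤ LF) (hszE : (disjList (Φn :: LE)).size ≤ LF)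
    (hB : 16 * LF + 60 ≤ B) :
    BD D B (14 + (Li.length + 2) * (35 + 6 * (LE.length + 2)))
      (disjList (neg (disjList (Φn :: Li)) :: Φn :: LE)) := by
  set Fi := disjList (Φn :: Li) with hFi
  have hdFi : Fi.dd ≤ 4 := dd_cons_le hΦ fun A hA => (hLi A hA).trans (by omega)
  have hdnFi : (neg Fi).dd ≤ 6 := (dd_neg_le_dd_add_two Fi).trans (by omega)
  have a1 : BD D B 1 (disjList (neg Fi :: Φn :: Li)) := by
    rw [disjList_cons]
    exact axB Fi ⟨by rw [dd_disj]; omega, by simp only [size]; omega⟩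
  have hsz1 : (disjList (neg Fi :: Φn :: Li)).size ≤ 2 * LF + 2 := by
    rw [size_disjList_cons, size, ← hFi]; omega
  have hszT : (disjList (neg Fi :: Φn :: LE)).size ≤ 2 * LF + 2 := by
    rw [size_disjList_cons, size]; omega
  have a2 := subsetB (L' := neg Fi :: Φn :: LE) a1 (fun A hA => by
      simp only [List.mem_cons] at hA ⊢
      rcases hA with rfl | rfl | hA
      · exact Or.inl rfl
      · exact Or.inr (Or.inl rfl)
      · exact Or.inr (Or.inr (hi A hA))) (p := 6) (fun X hX => by
      simp only [List.mem_cons] at hX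
      rcases hX with rfl | rfl | hX
      · exact hdnFi
      · omega
      · exact (hLE X hX).trans (by omega)) (by omega) (by omega)
  refine a2.mono ?_
  simp only [List.length_cons]
  nlinarith [Li.length.zero_le, LE.length.zero_le]

/-- **The final tautology** `¬(¬Φ ∨ ⊥) ∨ ¬Φ` (the empty clause's sequent implies `¬Φ`): axiom,
flattening of the pair, removal of the trailing `⊥`. [Shoenfield 1967, §2.6] [folklore] -/
theorem finalTaut {Φn : PropForm ℕ} (hD : 10 ≤ D) (hΦ : Φn.dd ≤ 4)
    (hB : 16 * Φn.size + 60 ≤ B) :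
    BD D B 10 (disj (neg (disjList [Φn])) Φn) := by
  set F0 := disjList [Φn] with hF0
  have hdF0 : F0.dd ≤ 4 := dd_cons_le hΦ (by simp)
  have hdnF0 : (neg F0).dd ≤ 6 := (dd_neg_le_dd_add_two F0).trans (by omega)
  have hszF0 : F0.size = Φn.size + 2 := by
    rw [hF0, size_disjList_cons, size_disjList_nil]
  have a1 : BD D B 1 (disjList [neg F0, Φn]) := by
    rw [disjList_cons]
    exact axB F0 ⟨by rw [dd_disj]; omega, by simp only [size]; omega⟩
  have a2 := consDisjS a1
  have e : disjList [disj (neg F0) Φn] = disj (disj (neg F0) Φn) (const false) := by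
    simp [disjList_cons]
  rw [e] at a2
  have a3 := removeBotB a2 (by
      have h1 := dd_neg_le_dd_add_two (disj (neg F0) Φn)
      rw [dd_disj] at h1
      omega) (by simp only [size]; omega)
  exact a3.mono (by omega)

/-- **The initial sequent** `⊢ ¬Φ, ⋁C` for a clause `c` of `T` rewritten on any list `L_C`
containing the literal formulas of `c` (conjunct extraction, flattening, structural rule).
[Shoenfield 1967, §3.1] [folklore] -/
theorem initialTaut {T : CNF ℕ} {c : Clause ℕ} (hc : c ∈ T) {LC : List (PropForm ℕ)} {LF : ℕ}
    (hD : 10 ≤ D) (hLC : ∀ A ∈ LC, A.dd ≤ 1) (hsub : ∀ l ∈ c, litOf l ∈ LC)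
    (hszT : (PropForm.ofCNF T).size + 3 ≤ LF)
    (hszC : (disjList (neg (PropForm.ofCNF T) :: LC)).size ≤ LF) (hB : 16 * LF + 60 ≤ B) :
    BD D B (34 + 126 * T.length + (c.length + 2) * (35 + 6 * (LC.length + 2)))
      (disjList (neg (PropForm.ofCNF T) :: LC)) := by
  have hΦeq : PropForm.ofCNF T = conjList (T.map clauseOf) := KrajicekRamsey.ofCNF_eq_conjList T
  have hdΦn : (neg (PropForm.ofCNF T)).dd ≤ 4 := by
    rw [hΦeq]
    exact (dd_neg_conjList_le (p := 1) fun X hX => by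
      obtain ⟨c', -, rfl⟩ := List.mem_map.1 hX
      exact dd_clauseOf_le c').trans (by omega)
  have hszcl : (clauseOf c).size ≤ (PropForm.ofCNF T).size := by
    rw [hΦeq, size_conjList_eq_msum]
    have : clauseOf c ∈ T.map clauseOf := List.mem_map.2 ⟨c, hc, rfl⟩
    have := msum_le_of_sublist (List.singleton_sublist.2 this)
    simp only [msum_cons, msum_nil] at this
    omega
  -- conjunct extraction `⊢ ¬Φ, clauseOf c`
  have e1 : BD D B (12 + 126 * T.length) (disjList [neg (PropForm.ofCNF T), clauseOf c]) := by
    have h := conjExtractS (M := T.map clauseOf) (A := clauseOf c) (D := D) (B := B)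
      (List.mem_map.2 ⟨c, hc, rfl⟩) (p := 1) (fun X hX => by
        obtain ⟨c', -, rfl⟩ := List.mem_map.1 hX
        exact dd_clauseOf_le c') (by omega) (by rw [← hΦeq]; omega)
    rw [List.length_map, ← hΦeq] at h
    exact h
  -- `⊢ (¬Φ ∨ clauseOf c), ⊥`, then drop `⊥`: the formula `¬Φ ∨ clauseOf c = ⋁(¬Φ :: c.map litOf)`
  have e2 := consDisjS e1
  have e : disjList [disj (neg (PropForm.ofCNF T)) (clauseOf c)] =
      disj (disjList (neg (PropForm.ofCNF T) :: c.map litOf)) (const false) := by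
    simp [disjList_cons, clauseOf]
  rw [e] at e2
  have hdc : (disjList (neg (PropForm.ofCNF T) :: c.map litOf)).dd ≤ 4 :=
    dd_cons_le hdΦn fun A hA => by
      obtain ⟨l, -, rfl⟩ := List.mem_map.1 hA
      exact (dd_litOf_le l).trans (by omega)
  have hszc : (disjList (neg (PropForm.ofCNF T) :: c.map litOf)).size ≤ 2 * LF := by
    rw [size_disjList_cons, size]
    have : (disjList (c.map litOf)).size = (clauseOf c).size := rfl
    omega
  have e3 := removeBotB e2 ((dd_neg_le_dd_add_two _).trans (by omega)) (by omega)
  -- structural rule onto `L_C`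
  have e4 := subsetB (L' := neg (PropForm.ofCNF T) :: LC) e3 (fun A hA => by
      simp only [List.mem_cons] at hA ⊢
      rcases hA with rfl | hA
      · exact Or.inl rfl
      · obtain ⟨l, hl, rfl⟩ := List.mem_map.1 hA
        exact Or.inr (hsub l hl)) (p := 4) (fun X hX => by
      simp only [List.mem_cons] at hX
      rcases hX with rfl | hX
      · exact hdΦn
      · exact (hLC X hX).trans (by omega)) (by omega) (by omega)
  refine e4.mono ?_
  simp only [List.length_cons, List.length_map]
  nlinarith [c.length.zero_le, LC.length.zero_le]

end Summit.PneNP.PneNP.Theorems.ResSim
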